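import Literature.NumberTheory.PAdicHodge.BaseGaloisAction
import Mathlib.RingTheory.Polynomial.Cyclotomic.Eval
import Mathlib.RingTheory.Polynomial.Cyclotomic.Roots
import Mathlib.Analysis.Normed.Ring.Finite
import HarnessLib

/-!
# The cyclotomic tower `ℚ_p(ζ_{p^m}) ⊆ F̄` with the absolute value of `F`

Continuation of `PadicBaseField` / `BaseGaloisAction`. For a non-archimedean local field `F` of
characteristic `0` and residue characteristic `p`, `K₀ = PadicBase F p hp ≅ ℚ_p` (normed by `F`),
`F̄ = NormedAlgClosure F`, `G₀ = BaseGaloisGroup hp = Gal(F̄/K₀)`, this file sets up the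
**cyclotomic `ℤ_p`-tower of the base field** inside `F̄`,

  `K m := K₀(ζ_{p^m})`  (`CyclotomicTower.K hp m`, `ζ_{p^m} = CyclotomicTower.zeta F p m`),

and proves the EXPLICIT metric facts on which Tate's normalised traces rest (Tate 1967, §3.1,
Prop. 5–6 and §3.2; here obtained without differents, from the absolute value alone):

* `norm_zeta_sub_one_pow` : `‖ζ_{p^m} - 1‖ ^ φ(p^m) = ‖p‖` (`m ≥ 1`): all `ζ^a - 1`, `p ∤ a`,
  have the same absolute value and their product is `Φ_{p^m}(1) = p`;
* `norm_coeff_mul_le_norm_aeval` (ORTHOGONALITY of the `π`-power basis, `π = ζ_{p^m} - 1`): for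
  `r ∈ K₀[X]` of degree `< φ(p^m)`, `‖r_j‖ ‖π‖^j ≤ ‖r(π)‖` for every `j` — the non-zero terms
  `r_j π^j` have pairwise distinct absolute values `‖p‖^{v_j + j/φ(p^m)}`, `v_j ∈ ℤ`
  (`PadicBase.norm_eq_norm_p_zpow`), so the ultrametric inequality is an equality; hence
  `norm_coeff_le` : `‖r_j‖ ≤ ‖p‖⁻¹ ‖r(π)‖`;
* consequences: `minpoly K₀ ζ_{p^m} = Φ_{p^m}` (`minpoly_zeta`, so `Φ_{p^m}` is irreducible over
  `ℚ_p` and `[K m : K₀] = φ(p^m)`), every element of `K m` is `r(ζ_{p^m}) = s(π)` with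
  `deg < φ(p^m)` (`exists_aeval_zeta_eq`), and the Galois supply: for `p ∤ a` some `g ∈ G₀` has
  `g • ζ_{p^m} = ζ_{p^m}^a` (`exists_smul_zeta_eq_pow`); two elements of `G₀` with the same action
  on `ζ_{p^m}` agree on `K m` (`smul_eq_smul_of_smul_zeta_eq`), `G₀` preserves `K m` and acts on
  it through an abelian quotient (`smul_comm_of_mem_K`).

## References

* J. Tate, *p-divisible groups*, Proc. Conf. Local Fields (Driebergen 1966), Springer 1967, §3.1
  (the tower `K_n = K(μ_{p^n})`, Prop. 5, 6) and §3.2. [Tate1967]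
* J.-M. Fontaine, Y. Ouyang, *Theory of p-adic Galois representations*, §1.5.4 and §3.1
  (cyclotomic tower, `v(ζ_{p^n} - 1) = 1/(p^{n-1}(p-1))`). [FontaineOuyang2022]
* J.-P. Serre, *Local Fields*, Ch. IV §4 (cyclotomic extensions of `ℚ_p`: totally ramified of
  degree `φ(p^m)`, uniformiser `ζ - 1`). [SerreLocalFields1979]
-/

noncomputable section

open ValuativeRel Field UniformSpace Polynomial

open scoped IntermediateField

namespace Literature.NumberTheory.PAdicHodge

open Literature.NumberTheory.GaloisRepresentations
open Literature.NumberTheory.GaloisRepresentations.IsNonarchimedeanLocalField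

variable {F : Type} [Field F] [ValuativeRel F] [TopologicalSpace F] [IsNonarchimedeanLocalField F]
  [CharZero F] {p : ℕ} [Fact p.Prime]

namespace CyclotomicTower

/-! ### `p`-power roots of unity in `F̄` -/

variable (F p) in
/-- **A primitive `p^m`-th root of unity `ζ_{p^m} ∈ F̄`** (a choice; `F̄` is algebraically closed of
characteristic `0`). [cite: Tate1967, §3.1] -/
def zeta (m : ℕ) : NormedAlgClosure F :=
  (HasEnoughRootsOfUnity.exists_primitiveRoot (NormedAlgClosure F) (p ^ m)).choose

variable (F p) in
/-- `ζ_{p^m}` is a primitive `p^m`-th root of unity. [folklore] -/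
theorem zeta_spec (m : ℕ) : IsPrimitiveRoot (zeta F p m) (p ^ m) :=
  (HasEnoughRootsOfUnity.exists_primitiveRoot (NormedAlgClosure F) (p ^ m)).choose_spec

omit [CharZero F] in
/-- `0 < p^m`. [folklore] -/
theorem pow_pos' (m : ℕ) : 0 < p ^ m := pow_pos (Fact.out : p.Prime).pos m

/-- `p^m ≠ 0` (instance form, for `IsPrimitiveRoot` lemmas). [folklore] -/
instance instNeZeroPow (m : ℕ) : NeZero (p ^ m) := ⟨(pow_pos' (p := p) m).ne'⟩

omit [CharZero F] in
/-- Roots of unity have absolute value `1`. [folklore] -/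
theorem norm_eq_one_of_pow_eq_one {x : NormedAlgClosure F} {m : ℕ} (hx : x ^ p ^ m = 1) :
    ‖x‖ = 1 :=
  (isOfFinOrder_iff_pow_eq_one.2 ⟨p ^ m, pow_pos' m, hx⟩).norm_eq_one

variable (F p) in
/-- `‖ζ_{p^m}‖ = 1`. [folklore] -/
theorem norm_zeta (m : ℕ) : ‖zeta F p m‖ = 1 :=
  norm_eq_one_of_pow_eq_one (zeta_spec F p m).pow_eq_one

/-- Every `p^m`-th root of unity of `F̄` is a power of `ζ_{p^m}`. [folklore] -/
theorem exists_pow_eq_of_pow_eq_one {x : NormedAlgClosure F} {m : ℕ} (hx : x ^ p ^ m = 1) :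
    ∃ i < p ^ m, zeta F p m ^ i = x :=
  (zeta_spec F p m).eq_pow_of_pow_eq_one hx

/-- `ζ_{p^m}` is a power of `ζ_{p^{m'}}` for `m ≤ m'`. [folklore] -/
theorem exists_zeta_eq_pow {m m' : ℕ} (h : m ≤ m') : ∃ i, zeta F p m = zeta F p m' ^ i := by
  have hx : zeta F p m ^ p ^ m' = 1 := by
    obtain ⟨k, rfl⟩ := Nat.exists_eq_add_of_le h
    rw [pow_add, pow_mul, (zeta_spec F p m).pow_eq_one, one_pow]
  obtain ⟨i, -, hi⟩ := (zeta_spec F p m').eq_pow_of_pow_eq_one hx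
  exact ⟨i, hi.symm⟩

omit [CharZero F] in
/-- For `‖x‖ ≤ 1`: `‖x^a - 1‖ ≤ ‖x - 1‖` (`x^a - 1 = (x - 1)(1 + x + ⋯ + x^{a-1})`). [folklore] -/
theorem norm_pow_sub_one_le {x : NormedAlgClosure F} (hx : ‖x‖ ≤ 1) (a : ℕ) :
    ‖x ^ a - 1‖ ≤ ‖x - 1‖ := by
  have h : x ^ a - 1 = (x - 1) * ∑ i ∈ Finset.range a, x ^ i := by
    rw [mul_comm, geom_sum_mul]
  rw [h, norm_mul]
  refine mul_le_of_le_one_right (norm_nonneg _) ?_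
  refine IsUltrametricDist.norm_sum_le_of_forall_le_of_nonneg zero_le_one fun i _ => ?_
  rw [norm_pow]; exact pow_le_one₀ (norm_nonneg _) hx

/-- All primitive `p^m`-th roots of unity `μ` have the same `‖μ - 1‖` as `ζ_{p^m}`. [folklore] -/
theorem norm_sub_one_eq_of_isPrimitiveRoot {m : ℕ} {μ : NormedAlgClosure F}
    (hμ : IsPrimitiveRoot μ (p ^ m)) : ‖μ - 1‖ = ‖zeta F p m - 1‖ := by
  obtain ⟨i, -, rfl⟩ := (zeta_spec F p m).eq_pow_of_pow_eq_one hμ.pow_eq_one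
  obtain ⟨j, -, hj⟩ := hμ.eq_pow_of_pow_eq_one (zeta_spec F p m).pow_eq_one
  apply le_antisymm
  · exact norm_pow_sub_one_le (norm_zeta F p m).le i
  · calc ‖zeta F p m - 1‖ = ‖(zeta F p m ^ i) ^ j - 1‖ := by rw [hj]
      _ ≤ ‖zeta F p m ^ i - 1‖ :=
          norm_pow_sub_one_le (norm_eq_one_of_pow_eq_one hμ.pow_eq_one).le j

/-- **`‖ζ_{p^m} - 1‖ ^ φ(p^m) = ‖p‖`** for `m ≥ 1`: the product of the `ζ^a - 1` over the primitive
`p^m`-th roots `ζ^a` is `± Φ_{p^m}(1) = ± p`, and all factors have the same absolute value.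
[cite: SerreLocalFields1979, Ch. IV §4] [cite: FontaineOuyang2022, §3.1] -/
theorem norm_zeta_sub_one_pow {m : ℕ} (hm : 1 ≤ m) :
    ‖zeta F p m - 1‖ ^ (p ^ m).totient = ‖(p : NormedAlgClosure F)‖ := by
  classical
  obtain ⟨k, rfl⟩ := Nat.exists_eq_add_of_le' hm
  have hζ := zeta_spec F p (k + 1)
  -- `Φ_{p^{k+1}}(1) = p` and `Φ = ∏ (X - μ)`
  have heval : ((cyclotomic (p ^ (k + 1)) (NormedAlgClosure F)).eval 1) = p :=
    eval_one_cyclotomic_prime_pow k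
  rw [cyclotomic_eq_prod_X_sub_primitiveRoots hζ, eval_prod] at heval
  simp only [eval_sub, eval_X, eval_C] at heval
  -- take norms
  have hnorm := congrArg (fun x : NormedAlgClosure F => ‖x‖) heval
  simp only [norm_prod] at hnorm
  rw [← hnorm]
  have hconst : ∀ μ ∈ primitiveRoots (p ^ (k + 1)) (NormedAlgClosure F),
      ‖1 - μ‖ = ‖zeta F p (k + 1) - 1‖ := by
    intro μ hμ
    rw [norm_sub_rev]
    exact norm_sub_one_eq_of_isPrimitiveRoot ((mem_primitiveRoots (pow_pos' (k + 1))).mp hμ)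
  rw [Finset.prod_congr rfl hconst, Finset.prod_const, hζ.card_primitiveRoots]

/-- `0 < ‖ζ_{p^m} - 1‖` for `m ≥ 1` (`ζ ≠ 1`). [folklore] -/
theorem norm_zeta_sub_one_pos {m : ℕ} (hm : 1 ≤ m) : 0 < ‖zeta F p m - 1‖ := by
  rw [norm_pos_iff, sub_ne_zero]
  intro h
  have h1 := (zeta_spec F p m).pow_eq_one_iff_dvd 1
  rw [pow_one] at h1
  have : p ^ m ∣ 1 := h1.mp h
  have hp1 : 1 < p ^ m := Nat.one_lt_pow (by omega) (Fact.out : p.Prime).one_lt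
  exact absurd (Nat.le_of_dvd one_pos this) (not_le.mpr hp1)

variable (hp : valuation F p < 1)

/-- **`‖ζ_{p^m} - 1‖ = ‖p‖ ^ {1/φ(p^m)}`** (`m ≥ 1`), with `‖p‖ = ‖p‖_{K₀}`.
[cite: FontaineOuyang2022, §3.1] -/
theorem norm_zeta_sub_one {m : ℕ} (hm : 1 ≤ m) :
    ‖zeta F p m - 1‖ = ‖(p : PadicBase F p hp)‖ ^ (1 / ((p ^ m).totient : ℝ)) := by
  have htot : (p ^ m).totient ≠ 0 := (Nat.totient_pos.mpr (pow_pos' m)).ne'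
  rw [← PadicBase.norm_natCast_closure hp, ← norm_zeta_sub_one_pow hm, one_div,
    Real.pow_rpow_inv_natCast (norm_nonneg _) htot]

/-! ### Orthogonality of the `π`-power basis over `K₀` -/

/-- `‖ζ_{p^m} - 1‖ ≤ 1`. [folklore] -/
theorem norm_zeta_sub_one_le_one (m : ℕ) : ‖zeta F p m - 1‖ ≤ 1 := by
  refine (norm_sub_le_max' _ _).trans (max_le (norm_zeta F p m).le ?_)
  rw [norm_one]

/-- The absolute values of the non-zero terms `c π^j`, `c ∈ K₀`, `j < φ(p^m)`, are pairwise
distinct: `‖c‖ ‖π‖^j = ‖c'‖ ‖π‖^{j'}` with `c, c' ≠ 0` forces `j = j'` (value group `‖p‖^ℤ` of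
`K₀` versus `‖π‖^{φ(p^m)} = ‖p‖`). [cite: SerreLocalFields1979, Ch. IV §4] -/
theorem eq_of_norm_mul_norm_pow_eq {m : ℕ} (hm : 1 ≤ m) {c c' : PadicBase F p hp} (hc : c ≠ 0)
    (hc' : c' ≠ 0) {j j' : ℕ} (hj : j < (p ^ m).totient) (hj' : j' < (p ^ m).totient)
    (h : ‖c‖ * ‖zeta F p m - 1‖ ^ j = ‖c'‖ * ‖zeta F p m - 1‖ ^ j') : j = j' := by
  set t : ℝ := ‖(p : PadicBase F p hp)‖ with ht
  have ht0 : 0 < t := PadicBase.norm_p_pos hp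
  have ht1 : t < 1 := PadicBase.norm_p_lt_one hp
  set φ : ℕ := (p ^ m).totient with hφ
  set π : NormedAlgClosure F := zeta F p m - 1 with hπdef
  have hπφ : ‖π‖ ^ φ = t := by
    rw [hπdef, hφ, norm_zeta_sub_one_pow hm, PadicBase.norm_natCast_closure hp]
  set v : ℤ := (PadicBase.toPadic hp c).valuation with hv
  set v' : ℤ := (PadicBase.toPadic hp c').valuation with hv'
  have hcv : ‖c‖ = t ^ v := PadicBase.norm_eq_norm_p_zpow hp c hc
  have hcv' : ‖c'‖ = t ^ v' := PadicBase.norm_eq_norm_p_zpow hp c' hc'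
  -- raise `h` to the `φ`-th power: `t^(v φ + j) = t^(v' φ + j')`
  have h2 := congrArg (fun x : ℝ => x ^ φ) h
  simp only [mul_pow] at h2
  rw [← pow_mul, ← pow_mul, mul_comm j φ, mul_comm j' φ, pow_mul, pow_mul, hπφ, hcv, hcv',
    ← zpow_natCast (t ^ v) φ, ← zpow_natCast (t ^ v') φ, ← zpow_mul, ← zpow_mul,
    ← zpow_natCast t j, ← zpow_natCast t j', ← zpow_add₀ ht0.ne', ← zpow_add₀ ht0.ne'] at h2
  have hexp : v * (φ : ℤ) + (j : ℤ) = v' * (φ : ℤ) + (j' : ℤ) :=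
    zpow_right_injective₀ ht0 ht1.ne h2
  have hdvd : (φ : ℤ) ∣ (j : ℤ) - j' := ⟨v' - v, by linear_combination hexp⟩
  have habs : |(j : ℤ) - j'| < φ := by
    rw [abs_sub_lt_iff]; constructor <;> omega
  have := Int.eq_zero_of_abs_lt_dvd hdvd habs
  omega

/-- `‖c • x‖ = ‖c‖ ‖x‖` for `c ∈ K₀`, `x ∈ F̄`. [folklore] -/
theorem norm_smul_base (c : PadicBase F p hp) (x : NormedAlgClosure F) : ‖c • x‖ = ‖c‖ * ‖x‖ := by
  rw [Algebra.smul_def, norm_mul, PadicBase.norm_algebraMap_closure]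

/-- **Orthogonality of the `π`-power basis** (`π = ζ_{p^m} - 1`): for `r ∈ K₀[X]` of degree
`< φ(p^m)` every term is dominated by the sum, `‖r_j‖ ‖π‖^j ≤ ‖r(π)‖` — the non-zero terms have
pairwise distinct absolute values, so the ultrametric inequality is an equality
(Mathlib `IsUltrametricDist.norm_sum_eq_sup'_of_pairwise_ne`).
[cite: SerreLocalFields1979, Ch. IV §4] [cite: Tate1967, §3.1] -/
theorem norm_coeff_mul_le_norm_aeval {m : ℕ} (hm : 1 ≤ m) (r : (PadicBase F p hp)[X])
    (hr : r.natDegree < (p ^ m).totient) (j : ℕ) :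
    ‖r.coeff j‖ * ‖zeta F p m - 1‖ ^ j ≤ ‖aeval (zeta F p m - 1) r‖ := by
  classical
  set π : NormedAlgClosure F := zeta F p m - 1 with hπdef
  by_cases hj0 : r.coeff j = 0
  · rw [hj0, norm_zero, zero_mul]; exact norm_nonneg _
  have hjdeg : j ≤ r.natDegree := le_natDegree_of_ne_zero hj0
  -- the sum over the support
  let f : ℕ → NormedAlgClosure F := fun i => r.coeff i • π ^ i
  let S : Finset ℕ := (Finset.range (r.natDegree + 1)).filter fun i => r.coeff i ≠ 0
  have hsum : aeval π r = ∑ i ∈ S, f i := by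
    rw [aeval_eq_sum_range, Finset.sum_filter_of_ne]
    intro i _ hi h0
    apply hi
    change r.coeff i • π ^ i = 0
    rw [h0, zero_smul]
  have hjS : j ∈ S := by
    simp only [S, Finset.mem_filter, Finset.mem_range]
    exact ⟨Nat.lt_succ_of_le hjdeg, hj0⟩
  have hSne : S.Nonempty := ⟨j, hjS⟩
  have hnormf : ∀ i, ‖f i‖ = ‖r.coeff i‖ * ‖π‖ ^ i := fun i => by
    change ‖r.coeff i • π ^ i‖ = _
    rw [norm_smul_base, norm_pow]
  have hpair : Set.Pairwise (S : Set ℕ) fun i i' => ‖f i‖ ≠ ‖f i'‖ := by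
    intro i hi i' hi' hii' heq
    simp only [S, Finset.coe_filter, Finset.mem_range, Set.mem_setOf_eq] at hi hi'
    rw [hnormf, hnormf] at heq
    exact hii' (eq_of_norm_mul_norm_pow_eq hp hm hi.2 hi'.2 (by omega) (by omega) heq)
  have key : ‖∑ i ∈ S, f i‖ = S.sup' hSne (fun i => ‖f i‖) :=
    IsUltrametricDist.norm_sum_eq_sup'_of_pairwise_ne hSne hpair
  rw [hsum, key, ← hnormf j]
  exact Finset.le_sup' (fun i => ‖f i‖) hjS

/-- **Coefficient bound**: `‖r_j‖ ≤ ‖p‖⁻¹ ‖r(π)‖` for `deg r < φ(p^m)` (`‖π‖^j ≥ ‖π‖^{φ(p^m)} = ‖p‖`).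
[cite: Tate1967, §3.1] -/
theorem norm_coeff_le {m : ℕ} (hm : 1 ≤ m) (r : (PadicBase F p hp)[X])
    (hr : r.natDegree < (p ^ m).totient) (j : ℕ) :
    ‖r.coeff j‖ ≤ ‖(p : PadicBase F p hp)‖⁻¹ * ‖aeval (zeta F p m - 1) r‖ := by
  by_cases hjd : r.natDegree < j
  · rw [coeff_eq_zero_of_natDegree_lt hjd, norm_zero]
    exact mul_nonneg (inv_nonneg.mpr (norm_nonneg _)) (norm_nonneg _)
  push Not at hjd
  have hjφ : j ≤ (p ^ m).totient := hjd.trans hr.le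
  have hπ1 := norm_zeta_sub_one_le_one (F := F) (p := p) m
  have hπp : ‖(p : PadicBase F p hp)‖ ≤ ‖zeta F p m - 1‖ ^ j := by
    calc ‖(p : PadicBase F p hp)‖ = ‖zeta F p m - 1‖ ^ (p ^ m).totient := by
          rw [norm_zeta_sub_one_pow hm, PadicBase.norm_natCast_closure hp]
      _ ≤ ‖zeta F p m - 1‖ ^ j := pow_le_pow_of_le_one (norm_nonneg _) hπ1 hjφ
  have hmain := norm_coeff_mul_le_norm_aeval hp hm r hr j
  have hp0 := PadicBase.norm_p_pos hp
  rw [le_inv_mul_iff₀' hp0]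
  calc ‖r.coeff j‖ * ‖(p : PadicBase F p hp)‖
      ≤ ‖r.coeff j‖ * ‖zeta F p m - 1‖ ^ j := mul_le_mul_of_nonneg_left hπp (norm_nonneg _)
    _ ≤ _ := hmain

/-! ### The minimal polynomial of `ζ_{p^m}` over `K₀` is `Φ_{p^m}` -/

/-- `Φ_{p^m}(ζ_{p^m}) = 0` over `K₀`. [folklore] -/
theorem aeval_zeta_cyclotomic (m : ℕ) :
    aeval (zeta F p m) (cyclotomic (p ^ m) (PadicBase F p hp)) = 0 := by
  haveI : NeZero ((p ^ m : ℕ) : NormedAlgClosure F) :=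
    ⟨by rw [Nat.cast_pow]; exact pow_ne_zero m (Nat.cast_ne_zero.mpr (Fact.out : p.Prime).ne_zero)⟩
  rw [aeval_def, eval₂_eq_eval_map, map_cyclotomic, ← IsRoot.def, isRoot_cyclotomic_iff]
  exact zeta_spec F p m

/-- **`minpoly_{K₀} ζ_{p^m} = Φ_{p^m}`** (`m ≥ 1`): `minpoly ∣ Φ_{p^m}`, and its degree is at least
`φ(p^m)` because a monic relation `q(ζ) = 0` of degree `d < φ(p^m)` would give `r(π) = 0` for
`r = q(X + 1)`, monic of degree `d`, contradicting the orthogonality of the `π`-powers. Hence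
`Φ_{p^m}` is irreducible over `ℚ_p` and `[K₀(ζ_{p^m}) : K₀] = φ(p^m)`.
[cite: SerreLocalFields1979, Ch. IV §4] -/
theorem minpoly_zeta {m : ℕ} (hm : 1 ≤ m) :
    minpoly (PadicBase F p hp) (zeta F p m) = cyclotomic (p ^ m) (PadicBase F p hp) := by
  set K₀ := PadicBase F p hp
  have hint : IsIntegral K₀ (zeta F p m) := Algebra.IsIntegral.isIntegral _
  set q : K₀[X] := minpoly K₀ (zeta F p m) with hq
  have hqmonic : q.Monic := minpoly.monic hint
  have hΦmonic : (cyclotomic (p ^ m) K₀).Monic := cyclotomic.monic _ _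
  have hdvd : q ∣ cyclotomic (p ^ m) K₀ := minpoly.dvd K₀ _ (aeval_zeta_cyclotomic hp m)
  -- degree bound from orthogonality
  have hdeg : (p ^ m).totient ≤ q.natDegree := by
    by_contra hlt
    push Not at hlt
    set r : K₀[X] := q.comp (X + 1) with hr
    have hX1 : (X + 1 : K₀[X]).natDegree = 1 := by
      rw [← C_1, natDegree_X_add_C]
    have hrdeg : r.natDegree = q.natDegree := by
      rw [hr, natDegree_comp, hX1, mul_one]
    have hrlead : r.coeff q.natDegree = 1 := by
      have h1 : r.leadingCoeff = 1 := by
        rw [hr, leadingCoeff_comp (by rw [hX1]; exact one_ne_zero), hqmonic.leadingCoeff,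
          show (X + 1 : K₀[X]) = X + C 1 by rw [C_1], leadingCoeff_X_add_C, one_pow, one_mul]
      rwa [leadingCoeff, hrdeg] at h1
    have hraeval : aeval (zeta F p m - 1) r = 0 := by
      rw [hr, aeval_comp, map_add, aeval_X, map_one, sub_add_cancel, hq, minpoly.aeval]
    have h := norm_coeff_mul_le_norm_aeval hp hm r (by rw [hrdeg]; exact hlt) q.natDegree
    rw [hrlead, norm_one, one_mul, hraeval, norm_zero] at h
    exact absurd h (not_le.mpr (pow_pos (norm_zeta_sub_one_pos hm) _))
  -- conclude
  have hΦdeg : (cyclotomic (p ^ m) K₀).natDegree ≤ q.natDegree := by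
    rw [natDegree_cyclotomic]; exact hdeg
  exact (Polynomial.eq_of_monic_of_dvd_of_natDegree_le hqmonic hΦmonic hdvd hΦdeg).symm

/-- **`Φ_{p^m}` is irreducible over `ℚ_p`** (normed as `K₀`). [cite: SerreLocalFields1979, Ch. IV §4] -/
theorem irreducible_cyclotomic {m : ℕ} (hm : 1 ≤ m) :
    Irreducible (cyclotomic (p ^ m) (PadicBase F p hp)) := by
  rw [← minpoly_zeta hp hm]
  exact minpoly.irreducible (Algebra.IsIntegral.isIntegral _)

/-- `deg minpoly_{K₀} ζ_{p^m} = φ(p^m)`. [folklore] -/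
theorem natDegree_minpoly_zeta {m : ℕ} (hm : 1 ≤ m) :
    (minpoly (PadicBase F p hp) (zeta F p m)).natDegree = (p ^ m).totient := by
  rw [minpoly_zeta hp hm, natDegree_cyclotomic]

/-! ### The fields `K m = K₀(ζ_{p^m})` -/

/-- **The `m`-th layer of the cyclotomic tower of the base field**: `K m = K₀(ζ_{p^m}) ⊆ F̄`
(`= K₀(μ_{p^m})`, `mem_K_of_pow_eq_one`). [cite: Tate1967, §3.1] -/
def K (m : ℕ) : IntermediateField (PadicBase F p hp) (NormedAlgClosure F) :=
  (PadicBase F p hp)⟮zeta F p m⟯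

/-- Unfolding of `K`. [folklore] -/
theorem K_def (m : ℕ) : K hp m = (PadicBase F p hp)⟮zeta F p m⟯ := rfl

/-- `ζ_{p^m} ∈ K m`. [folklore] -/
theorem zeta_mem_K (m : ℕ) : zeta F p m ∈ K hp m :=
  IntermediateField.mem_adjoin_simple_self _ _

/-- `K m` contains all `p^m`-th roots of unity of `F̄`. [folklore] -/
theorem mem_K_of_pow_eq_one {m : ℕ} {x : NormedAlgClosure F} (hx : x ^ p ^ m = 1) : x ∈ K hp m := by
  obtain ⟨i, -, rfl⟩ := exists_pow_eq_of_pow_eq_one hx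
  exact pow_mem (zeta_mem_K hp m) i

/-- The tower is increasing: `K m ≤ K m'` for `m ≤ m'`. [folklore] -/
theorem K_mono : Monotone (K hp) := by
  intro m m' h
  rw [K_def, IntermediateField.adjoin_simple_le_iff]
  obtain ⟨i, hi⟩ := exists_zeta_eq_pow (F := F) (p := p) h
  rw [hi]
  exact pow_mem (zeta_mem_K hp m') i

/-- **Elements of `K m` are polynomials in `ζ_{p^m}` of degree `< φ(p^m)`** over `K₀`. [folklore] -/
theorem exists_aeval_zeta_eq {m : ℕ} {x : NormedAlgClosure F} (hx : x ∈ K hp m) :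
    ∃ r : (PadicBase F p hp)[X], r.natDegree < (p ^ m).totient ∧ aeval (zeta F p m) r = x := by
  set K₀ := PadicBase F p hp
  have halg : IsAlgebraic K₀ (zeta F p m) := Algebra.IsAlgebraic.isAlgebraic _
  have hx' : x ∈ (K hp m).toSubalgebra := hx
  rw [K_def, IntermediateField.adjoin_simple_toSubalgebra_of_isAlgebraic halg,
    Algebra.adjoin_singleton_eq_range_aeval] at hx'
  obtain ⟨q, rfl⟩ := hx'
  have hΦmonic : (cyclotomic (p ^ m) K₀).Monic := cyclotomic.monic _ _
  have hΦ1 : cyclotomic (p ^ m) K₀ ≠ 1 := by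
    intro h
    have := congrArg natDegree h
    rw [natDegree_cyclotomic, natDegree_one] at this
    exact (Nat.totient_pos.mpr (pow_pos' m)).ne' this
  refine ⟨q %ₘ cyclotomic (p ^ m) K₀, ?_, ?_⟩
  · rw [← natDegree_cyclotomic (p ^ m) K₀]
    exact natDegree_modByMonic_lt q hΦmonic hΦ1
  · exact aeval_modByMonic_eq_self_of_root (aeval_zeta_cyclotomic hp m)

/-- Elements of `K m` are polynomials in `π = ζ_{p^m} - 1` of degree `< φ(p^m)` over `K₀`. [folklore] -/
theorem exists_aeval_pi_eq {m : ℕ} {x : NormedAlgClosure F} (hx : x ∈ K hp m) :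
    ∃ s : (PadicBase F p hp)[X], s.natDegree < (p ^ m).totient ∧
      aeval (zeta F p m - 1) s = x := by
  obtain ⟨r, hr, rfl⟩ := exists_aeval_zeta_eq hp hx
  refine ⟨r.comp (X + 1), ?_, ?_⟩
  · have hX1 : (X + 1 : (PadicBase F p hp)[X]).natDegree = 1 := by
      rw [← C_1, natDegree_X_add_C]
    rw [natDegree_comp, hX1, mul_one]; exact hr
  · rw [aeval_comp, map_add, aeval_X, map_one, sub_add_cancel]

/-- **The coefficient bound on `K m`**: if `x = s(π) ∈ K m` with `deg s < φ(p^m)` then every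
coefficient satisfies `‖s_j‖ ≤ ‖p‖⁻¹ ‖x‖` (restatement of `norm_coeff_le`). [cite: Tate1967, §3.1] -/
theorem norm_coeff_le_of_aeval_eq {m : ℕ} (hm : 1 ≤ m) (s : (PadicBase F p hp)[X])
    (hs : s.natDegree < (p ^ m).totient) (j : ℕ) :
    ‖s.coeff j‖ ≤ ‖(p : PadicBase F p hp)‖⁻¹ * ‖aeval (zeta F p m - 1) s‖ :=
  norm_coeff_le hp hm s hs j

/-! ### Galois action on the layers -/

/-- **Galois supply**: for `p ∤ a` there is `g ∈ G₀` with `g • ζ_{p^m} = ζ_{p^m}^a` (`ζ^a` is a root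
of `Φ_{p^m} = minpoly_{K₀} ζ`, and conjugates are `G₀`-conjugate). [cite: Tate1967, §3.1] -/
theorem exists_smul_zeta_eq_pow {m : ℕ} (hm : 1 ≤ m) {a : ℕ} (ha : a.Coprime p) :
    ∃ g : BaseGaloisGroup hp, g • zeta F p m = zeta F p m ^ a := by
  have hprim : IsPrimitiveRoot (zeta F p m ^ a) (p ^ m) :=
    (zeta_spec F p m).pow_of_coprime a (ha.pow_right m)
  have hroot : zeta F p m ^ a ∈
      (minpoly (PadicBase F p hp) (zeta F p m)).aroots (NormedAlgClosure F) := by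
    rw [mem_aroots, minpoly_zeta hp hm]
    refine ⟨(cyclotomic.monic _ _).ne_zero, ?_⟩
    haveI : NeZero ((p ^ m : ℕ) : NormedAlgClosure F) :=
      ⟨by rw [Nat.cast_pow]; exact pow_ne_zero m (Nat.cast_ne_zero.mpr (Fact.out : p.Prime).ne_zero)⟩
    rw [aeval_def, eval₂_eq_eval_map, map_cyclotomic, ← IsRoot.def, isRoot_cyclotomic_iff]
    exact hprim
  obtain ⟨g, hg⟩ := BaseGaloisGroup.exists_smul_eq_of_mem_aroots hp _ _ hroot
  exact ⟨g, hg.symm⟩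

/-- Every `g ∈ G₀` maps `ζ_{p^m}` to a power `ζ_{p^m}^c`, `c < p^m`. [folklore] -/
theorem exists_smul_zeta_eq (g : BaseGaloisGroup hp) (m : ℕ) :
    ∃ c < p ^ m, g • zeta F p m = zeta F p m ^ c := by
  have h1 : (g • zeta F p m) ^ p ^ m = 1 := by
    rw [← smul_pow', (zeta_spec F p m).pow_eq_one, smul_one]
  obtain ⟨c, hc, h⟩ := exists_pow_eq_of_pow_eq_one h1
  exact ⟨c, hc, h.symm⟩

/-- **Two elements of `G₀` with the same action on `ζ_{p^m}` agree on `K m`.** [folklore] -/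
theorem smul_eq_smul_of_smul_zeta_eq {m : ℕ} {g g' : BaseGaloisGroup hp}
    (h : g • zeta F p m = g' • zeta F p m) {x : NormedAlgClosure F}
    (hx : x ∈ K hp m) : g • x = g' • x := by
  set K₀ := PadicBase F p hp
  have halg : IsAlgebraic K₀ (zeta F p m) := Algebra.IsAlgebraic.isAlgebraic _
  have hx' : x ∈ (K hp m).toSubalgebra := hx
  rw [K_def, IntermediateField.adjoin_simple_toSubalgebra_of_isAlgebraic halg] at hx'
  have hle : Algebra.adjoin K₀ {zeta F p m} ≤
      AlgHom.equalizer (g : NormedAlgClosure F →ₐ[K₀] NormedAlgClosure F)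
        (g' : NormedAlgClosure F →ₐ[K₀] NormedAlgClosure F) :=
    Algebra.adjoin_le (Set.singleton_subset_iff.mpr h)
  exact hle hx'

/-- `G₀` preserves each layer `K m`. [folklore] -/
theorem smul_mem_K (g : BaseGaloisGroup hp) {m : ℕ} {x : NormedAlgClosure F} (hx : x ∈ K hp m) :
    g • x ∈ K hp m := by
  set K₀ := PadicBase F p hp
  have halg : IsAlgebraic K₀ (zeta F p m) := Algebra.IsAlgebraic.isAlgebraic _
  have hx' : x ∈ (K hp m).toSubalgebra := hx
  rw [K_def, IntermediateField.adjoin_simple_toSubalgebra_of_isAlgebraic halg,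
    Algebra.adjoin_singleton_eq_range_aeval] at hx'
  obtain ⟨q, rfl⟩ := hx'
  obtain ⟨c, -, hc⟩ := exists_smul_zeta_eq hp g m
  have hg : (g : NormedAlgClosure F →ₐ[K₀] NormedAlgClosure F) (zeta F p m) = zeta F p m ^ c := hc
  change (g : NormedAlgClosure F →ₐ[K₀] NormedAlgClosure F) (aeval (zeta F p m) q) ∈ K hp m
  have hy : zeta F p m ^ c ∈ K hp m := pow_mem (zeta_mem_K hp m) c
  rw [← aeval_algHom_apply, hg,
    show zeta F p m ^ c = ((⟨_, hy⟩ : K hp m) : NormedAlgClosure F) from rfl,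
    IntermediateField.aeval_coe]
  exact SetLike.coe_mem _

/-- **`G₀` acts on `K m` through an abelian quotient**: `g • g' • x = g' • g • x` for `x ∈ K m`.
[cite: Tate1967, §3.1] -/
theorem smul_comm_of_mem_K (g g' : BaseGaloisGroup hp) {m : ℕ} {x : NormedAlgClosure F}
    (hx : x ∈ K hp m) : g • g' • x = g' • g • x := by
  obtain ⟨c, -, hc⟩ := exists_smul_zeta_eq hp g m
  obtain ⟨c', -, hc'⟩ := exists_smul_zeta_eq hp g' m
  have h : (g * g') • zeta F p m = (g' * g) • zeta F p m := by
    rw [mul_smul, mul_smul, hc', smul_pow', hc, smul_pow', hc', ← pow_mul, ← pow_mul, mul_comm]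
  have := smul_eq_smul_of_smul_zeta_eq hp h hx
  rwa [mul_smul, mul_smul] at this

end CyclotomicTower

end Literature.NumberTheory.PAdicHodge

end
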